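import Summits.NavierStokesRegularity.NavierStokesRegularity.Theses.CoreLogGas
import Summits.NavierStokesRegularity.NavierStokesRegularity.Theorems.CoreLogGasBlowupIsLocallyDrivenRateReduction

/-!
# RESTATEMENT of crux B `CoreLogGas.BlowupIsLocallyDriven` (stmt-NavierStokesRegularity-11291) and of crux A
# `CoreLogGas.LocallyDrivenIsTypeI` (stmt-NavierStokesRegularity-11290) — evidence file of lead c4, NOT a proposal

Verdict of this seat: **misstated** (the item is wrong AS FILED). The filed locality hypothesis `H(M,t₀,g)` bounds the
ABSOLUTE far-strain defect at ONE fixed `M` by `g ∈ L¹(t₀,T)`. Kernel-checked consequences already in the tree: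

* `Theorems.BlowupIsLocallyDriven.Negative.BlowupIsLocallyDriven_false_of_RigidFarStrainBlowup` (p154961): any maximal
  solution whose far-strain FRACTION at admissible deep peaks stays `≥ c > 0` near `T` (every rigid / discretely
  self-similar collapse with a nonzero shape constant: the refuters' closed forms give sheet `(2/π)/M`, off-axis tube
  `0.37–0.54/M⁴`, antiparallel pair `3Γd²/(16πM⁴ρ⁴)`, ring `≈ M⁻²`, blob tails `> 0`) violates `H` for EVERY `M`
  (fixed fraction × `∫Ω = ∞`, BKM). So the filed B does not separate "tube / tight binary / blob" (declared TRUE in its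
  docstring) from "sheet" (declared FALSE): it fails them all alike, and holds only for blow-ups that de-concentrate their
  fixed-`M` far-strain fraction — not the route's claim.
* `Theorems.BlowupIsLocallyDriven.Registered.blowupIsLocallyDriven_iff_shellLocalityCollapse` (p156404): the only line's only
  open stub is the crux itself; B as filed is sandwiched between `NoBlowup` (⇒ B, vacuity) and the exclusion of every
  rigidly far-strained blow-up (⇐ B), both out of reach.

WHAT THE STATEMENT SHOULD SAY (refuters R1/R2 `B_quadratic`, leads c1–c4): replace `H` in BOTH cruxes by the SCALE-FREE
modulus with rate `p = 2` (window `1 < p ≤ 2`: sheets `M⁻¹` must fail, rings saturate `M⁻²`):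

  `H₂(C,t₀,g) :≡ ∀ M ≥ 1, ∀ t ∈ Ico t₀ T, ∀ admissible (x,ρ), ∀ unit e, |⟪defect_{Mρ} e, e⟫| ≤ C / M ^ 2 * Ω(t) + g t`,
  `Ω(t) = ⨆ z, ‖curl (u t) z‖`, with `0 ≤ C`, `g` integrable on `Ico t₀ T`.

* `B_rate2` below — crux B re-typed: `… → ∃ C t₀ g, 0 ≤ C ∧ 0 ≤ t₀ ∧ t₀ < T ∧ IntegrableOn g (Ico t₀ T) ∧ H₂(C,t₀,g)`.
  Its text is VERBATIM the conclusion of the landed `Rate.bRate_of_shellRate` (p158280), checked here by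
  `B_rate2_of_shellRate2` (a one-term proof), so the landed far-field reduction serves it by name on day one; the
  landed enstrophy (p148607), far-field (p152530), cores-collapse (p153086) and BKM-majorant (p154961) files are reusable
  unchanged, and the new load-bearing stub is `ShellRate2` (shell strain fraction `≤ C/M²` up to `L¹`) — a statement
  about the SHAPE of the collapsing structure (sheet vs core), which is what the route's docstring argues.
* `A_rate2` below — crux A re-typed with hypothesis `∃ C t₀ g, … ∧ H₂(C,t₀,g)`; conclusion `IsTypeIBlowup u T` unchanged.
* `closes_rate2` — the deciding theorem keeps its shape: `A_rate2 → B_rate2 → NoTypeIBlowup → NoBlowupToClay →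
  NavierStokesRegularity` (pure logic, same proof as `CoreLogGas.closes`).
* `B_rate2_xi` / `A_rate2_xi` / `closes_rate2_xi` — the weaker STRETCHING-DIRECTION variant (lead c3): the modulus only
  for `e = ξ(t,x)`, division-free; `B_rate2 → B_rate2_xi` is the landed `Rate.bRateStretch_of_bRate`.

All decls elaborate standalone against the route file's own imports (+ the landed RateReduction file for the two
bridging theorems). `lean check`: rc 0, 0 sorries. Scratch namespace; nothing here is proposed to the tree.
-/

noncomputable section

open Set MeasureTheory Filter Topology Metric

-- justification: scratch namespace under the crux's Cruxes/ path (evidence file, not proposed).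
set_option linter.dupNamespace false

namespace Summit.NavierStokesRegularity.NavierStokesRegularity.Cruxes.BlowupIsLocallyDriven.RestatementC4

/-! ### The re-typed cruxes (texts to paste into `route edit`) -/

/-- **B re-typed (`B_rate2`)**: every maximal finite-energy classical solution from Clay data admits `C ≥ 0`, `t₀ < T`
and an integrable `g` on `[t₀,T)` such that for ALL `M ≥ 1`, at every deep near-maximum vorticity point `x` with
canonical core radius `ρ` and every unit `e`, the symmetric velocity gradient induced at `x` by the vorticity outside
`B(x,Mρ)` is at most `C/M² · Ω(t) + g(t)`. -/
def B_rate2 : Prop :=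
  ∀ (ν T : ℝ), 0 < ν → 0 < T →
    ∀ (u : ℝ → EuclideanSpace ℝ (Fin 3) → EuclideanSpace ℝ (Fin 3)) (p : ℝ → EuclideanSpace ℝ (Fin 3) → ℝ),
      Literature.Analysis.FluidPDE.IsMaximalSmoothSolution ν 0 u p T →
      Literature.Analysis.FluidPDE.IsLerayHopfOn T ν 0 (u 0) u →
      Literature.Analysis.FluidPDE.HasRapidSpatialDecay (u 0) →
      ∃ (C t₀ : ℝ) (g : ℝ → ℝ), 0 ≤ C ∧ 0 ≤ t₀ ∧ t₀ < T ∧ MeasureTheory.IntegrableOn g (Set.Ico t₀ T) ∧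
        ∀ (M : ℝ), 1 ≤ M → ∀ t ∈ Set.Ico t₀ T, ∀ (x : EuclideanSpace ℝ (Fin 3)) (ρ : ℝ), 0 < ρ →
          (⨆ z, ‖Literature.Analysis.FluidPDE.curl (u t) z‖) ≤ 2 * ‖Literature.Analysis.FluidPDE.curl (u t) x‖ →
          Metric.ball x ρ ⊆ {y | (⨆ z, ‖Literature.Analysis.FluidPDE.curl (u t) z‖) ≤ 4 * ‖Literature.Analysis.FluidPDE.curl (u t) y‖} →
          (∀ (x' : EuclideanSpace ℝ (Fin 3)) (ρ' : ℝ),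
            (⨆ z, ‖Literature.Analysis.FluidPDE.curl (u t) z‖) ≤ 2 * ‖Literature.Analysis.FluidPDE.curl (u t) x'‖ →
            Metric.ball x' ρ' ⊆ {y | (⨆ z, ‖Literature.Analysis.FluidPDE.curl (u t) z‖) ≤ 4 * ‖Literature.Analysis.FluidPDE.curl (u t) y‖} →
            ρ' ≤ 2 * ρ) →
          ∀ e : EuclideanSpace ℝ (Fin 3), ‖e‖ = 1 →
            |inner ℝ ((fderiv ℝ (u t) x - fderiv ℝ (fun z : EuclideanSpace ℝ (Fin 3) => ∫ y, (4 * Real.pi * ‖z - y‖ ^ 3)⁻¹ • Literature.Analysis.FluidPDE.cross ((Metric.ball x (M * ρ)).indicator (Literature.Analysis.FluidPDE.curl (u t)) y) (z - y)) x) e) e|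
              ≤ C / M ^ 2 * (⨆ z, ‖Literature.Analysis.FluidPDE.curl (u t) z‖) + g t

/-- **A re-typed (`A_rate2`)**: a maximal finite-energy classical solution from Clay data satisfying the scale-free
locality modulus `H₂(C,t₀,g)` blows up at the Type-I rate. -/
def A_rate2 : Prop :=
  ∀ (ν T : ℝ), 0 < ν → 0 < T →
    ∀ (u : ℝ → EuclideanSpace ℝ (Fin 3) → EuclideanSpace ℝ (Fin 3)) (p : ℝ → EuclideanSpace ℝ (Fin 3) → ℝ),
      Literature.Analysis.FluidPDE.IsMaximalSmoothSolution ν 0 u p T →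
      Literature.Analysis.FluidPDE.IsLerayHopfOn T ν 0 (u 0) u →
      Literature.Analysis.FluidPDE.HasRapidSpatialDecay (u 0) →
      (∃ (C t₀ : ℝ) (g : ℝ → ℝ), 0 ≤ C ∧ 0 ≤ t₀ ∧ t₀ < T ∧ MeasureTheory.IntegrableOn g (Set.Ico t₀ T) ∧
        ∀ (M : ℝ), 1 ≤ M → ∀ t ∈ Set.Ico t₀ T, ∀ (x : EuclideanSpace ℝ (Fin 3)) (ρ : ℝ), 0 < ρ →
          (⨆ z, ‖Literature.Analysis.FluidPDE.curl (u t) z‖) ≤ 2 * ‖Literature.Analysis.FluidPDE.curl (u t) x‖ →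
          Metric.ball x ρ ⊆ {y | (⨆ z, ‖Literature.Analysis.FluidPDE.curl (u t) z‖) ≤ 4 * ‖Literature.Analysis.FluidPDE.curl (u t) y‖} →
          (∀ (x' : EuclideanSpace ℝ (Fin 3)) (ρ' : ℝ),
            (⨆ z, ‖Literature.Analysis.FluidPDE.curl (u t) z‖) ≤ 2 * ‖Literature.Analysis.FluidPDE.curl (u t) x'‖ →
            Metric.ball x' ρ' ⊆ {y | (⨆ z, ‖Literature.Analysis.FluidPDE.curl (u t) z‖) ≤ 4 * ‖Literature.Analysis.FluidPDE.curl (u t) y‖} →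
            ρ' ≤ 2 * ρ) →
          ∀ e : EuclideanSpace ℝ (Fin 3), ‖e‖ = 1 →
            |inner ℝ ((fderiv ℝ (u t) x - fderiv ℝ (fun z : EuclideanSpace ℝ (Fin 3) => ∫ y, (4 * Real.pi * ‖z - y‖ ^ 3)⁻¹ • Literature.Analysis.FluidPDE.cross ((Metric.ball x (M * ρ)).indicator (Literature.Analysis.FluidPDE.curl (u t)) y) (z - y)) x) e) e|
              ≤ C / M ^ 2 * (⨆ z, ‖Literature.Analysis.FluidPDE.curl (u t) z‖) + g t) →
      Literature.Analysis.FluidPDE.IsTypeIBlowup u T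

/-- **The new load-bearing stub (`ShellRate2`)**: rate-form shell locality — at every admissible `(t,x,ρ)` with
`Mρ ≤ R` the vorticity in the shell `B(x,R) ∖ B(x,Mρ)` strains the peak at most at `C/M² · Ω(t) + g₁(t)`, for ALL
`M ≥ 1` (the hypothesis of the landed `Rate.bRate_of_shellRate`, verbatim). -/
def ShellRate2 : Prop :=
  ∀ (ν T : ℝ), 0 < ν → 0 < T →
    ∀ (u : ℝ → EuclideanSpace ℝ (Fin 3) → EuclideanSpace ℝ (Fin 3)) (p : ℝ → EuclideanSpace ℝ (Fin 3) → ℝ),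
      Literature.Analysis.FluidPDE.IsMaximalSmoothSolution ν 0 u p T →
      Literature.Analysis.FluidPDE.IsLerayHopfOn T ν 0 (u 0) u →
      Literature.Analysis.FluidPDE.HasRapidSpatialDecay (u 0) →
      ∃ (C t₀ R : ℝ) (g₁ : ℝ → ℝ), 0 ≤ C ∧ 0 ≤ t₀ ∧ t₀ < T ∧ 0 < R ∧
        MeasureTheory.IntegrableOn g₁ (Set.Ico t₀ T) ∧
        ∀ (M : ℝ), 1 ≤ M → ∀ t ∈ Set.Ico t₀ T, ∀ (x : EuclideanSpace ℝ (Fin 3)) (ρ : ℝ), 0 < ρ → M * ρ ≤ R →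
          (⨆ z, ‖Literature.Analysis.FluidPDE.curl (u t) z‖) ≤ 2 * ‖Literature.Analysis.FluidPDE.curl (u t) x‖ →
          Metric.ball x ρ ⊆ {y | (⨆ z, ‖Literature.Analysis.FluidPDE.curl (u t) z‖) ≤ 4 * ‖Literature.Analysis.FluidPDE.curl (u t) y‖} →
          (∀ (x' : EuclideanSpace ℝ (Fin 3)) (ρ' : ℝ),
            (⨆ z, ‖Literature.Analysis.FluidPDE.curl (u t) z‖) ≤ 2 * ‖Literature.Analysis.FluidPDE.curl (u t) x'‖ →
            Metric.ball x' ρ' ⊆ {y | (⨆ z, ‖Literature.Analysis.FluidPDE.curl (u t) z‖) ≤ 4 * ‖Literature.Analysis.FluidPDE.curl (u t) y‖} →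
            ρ' ≤ 2 * ρ) →
          ∀ e : EuclideanSpace ℝ (Fin 3), ‖e‖ = 1 →
            |inner ℝ ((fderiv ℝ (fun z : EuclideanSpace ℝ (Fin 3) => ∫ y, (4 * Real.pi * ‖z - y‖ ^ 3)⁻¹ • Literature.Analysis.FluidPDE.cross ((Metric.ball x R).indicator (Literature.Analysis.FluidPDE.curl (u t)) y) (z - y)) x
              - fderiv ℝ (fun z : EuclideanSpace ℝ (Fin 3) => ∫ y, (4 * Real.pi * ‖z - y‖ ^ 3)⁻¹ • Literature.Analysis.FluidPDE.cross ((Metric.ball x (M * ρ)).indicator (Literature.Analysis.FluidPDE.curl (u t)) y) (z - y)) x) e) e|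
              ≤ C / M ^ 2 * (⨆ z, ‖Literature.Analysis.FluidPDE.curl (u t) z‖) + g₁ t

/-- **B re-typed, stretching direction only (`B_rate2_xi`)**: the modulus for `e = ξ(t,x) = ω(t,x)/|ω(t,x)|`, written
without division. -/
def B_rate2_xi : Prop :=
  ∀ (ν T : ℝ), 0 < ν → 0 < T →
    ∀ (u : ℝ → EuclideanSpace ℝ (Fin 3) → EuclideanSpace ℝ (Fin 3)) (p : ℝ → EuclideanSpace ℝ (Fin 3) → ℝ),
      Literature.Analysis.FluidPDE.IsMaximalSmoothSolution ν 0 u p T →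
      Literature.Analysis.FluidPDE.IsLerayHopfOn T ν 0 (u 0) u →
      Literature.Analysis.FluidPDE.HasRapidSpatialDecay (u 0) →
      ∃ (C t₀ : ℝ) (g : ℝ → ℝ), 0 ≤ C ∧ 0 ≤ t₀ ∧ t₀ < T ∧ MeasureTheory.IntegrableOn g (Set.Ico t₀ T) ∧
        ∀ (M : ℝ), 1 ≤ M → ∀ t ∈ Set.Ico t₀ T, ∀ (x : EuclideanSpace ℝ (Fin 3)) (ρ : ℝ), 0 < ρ →
          (⨆ z, ‖Literature.Analysis.FluidPDE.curl (u t) z‖) ≤ 2 * ‖Literature.Analysis.FluidPDE.curl (u t) x‖ →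
          Metric.ball x ρ ⊆ {y | (⨆ z, ‖Literature.Analysis.FluidPDE.curl (u t) z‖) ≤ 4 * ‖Literature.Analysis.FluidPDE.curl (u t) y‖} →
          (∀ (x' : EuclideanSpace ℝ (Fin 3)) (ρ' : ℝ),
            (⨆ z, ‖Literature.Analysis.FluidPDE.curl (u t) z‖) ≤ 2 * ‖Literature.Analysis.FluidPDE.curl (u t) x'‖ →
            Metric.ball x' ρ' ⊆ {y | (⨆ z, ‖Literature.Analysis.FluidPDE.curl (u t) z‖) ≤ 4 * ‖Literature.Analysis.FluidPDE.curl (u t) y‖} →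
            ρ' ≤ 2 * ρ) →
          |inner ℝ ((fderiv ℝ (u t) x - fderiv ℝ (fun z : EuclideanSpace ℝ (Fin 3) => ∫ y, (4 * Real.pi * ‖z - y‖ ^ 3)⁻¹ • Literature.Analysis.FluidPDE.cross ((Metric.ball x (M * ρ)).indicator (Literature.Analysis.FluidPDE.curl (u t)) y) (z - y)) x)
              (Literature.Analysis.FluidPDE.curl (u t) x)) (Literature.Analysis.FluidPDE.curl (u t) x)|
            ≤ (C / M ^ 2 * (⨆ z, ‖Literature.Analysis.FluidPDE.curl (u t) z‖) + g t) *
                ‖Literature.Analysis.FluidPDE.curl (u t) x‖ ^ 2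

/-- **A re-typed, stretching direction only (`A_rate2_xi`)**. -/
def A_rate2_xi : Prop :=
  ∀ (ν T : ℝ), 0 < ν → 0 < T →
    ∀ (u : ℝ → EuclideanSpace ℝ (Fin 3) → EuclideanSpace ℝ (Fin 3)) (p : ℝ → EuclideanSpace ℝ (Fin 3) → ℝ),
      Literature.Analysis.FluidPDE.IsMaximalSmoothSolution ν 0 u p T →
      Literature.Analysis.FluidPDE.IsLerayHopfOn T ν 0 (u 0) u →
      Literature.Analysis.FluidPDE.HasRapidSpatialDecay (u 0) →
      (∃ (C t₀ : ℝ) (g : ℝ → ℝ), 0 ≤ C ∧ 0 ≤ t₀ ∧ t₀ < T ∧ MeasureTheory.IntegrableOn g (Set.Ico t₀ T) ∧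
        ∀ (M : ℝ), 1 ≤ M → ∀ t ∈ Set.Ico t₀ T, ∀ (x : EuclideanSpace ℝ (Fin 3)) (ρ : ℝ), 0 < ρ →
          (⨆ z, ‖Literature.Analysis.FluidPDE.curl (u t) z‖) ≤ 2 * ‖Literature.Analysis.FluidPDE.curl (u t) x‖ →
          Metric.ball x ρ ⊆ {y | (⨆ z, ‖Literature.Analysis.FluidPDE.curl (u t) z‖) ≤ 4 * ‖Literature.Analysis.FluidPDE.curl (u t) y‖} →
          (∀ (x' : EuclideanSpace ℝ (Fin 3)) (ρ' : ℝ),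
            (⨆ z, ‖Literature.Analysis.FluidPDE.curl (u t) z‖) ≤ 2 * ‖Literature.Analysis.FluidPDE.curl (u t) x'‖ →
            Metric.ball x' ρ' ⊆ {y | (⨆ z, ‖Literature.Analysis.FluidPDE.curl (u t) z‖) ≤ 4 * ‖Literature.Analysis.FluidPDE.curl (u t) y‖} →
            ρ' ≤ 2 * ρ) →
          |inner ℝ ((fderiv ℝ (u t) x - fderiv ℝ (fun z : EuclideanSpace ℝ (Fin 3) => ∫ y, (4 * Real.pi * ‖z - y‖ ^ 3)⁻¹ • Literature.Analysis.FluidPDE.cross ((Metric.ball x (M * ρ)).indicator (Literature.Analysis.FluidPDE.curl (u t)) y) (z - y)) x)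
              (Literature.Analysis.FluidPDE.curl (u t) x)) (Literature.Analysis.FluidPDE.curl (u t) x)|
            ≤ (C / M ^ 2 * (⨆ z, ‖Literature.Analysis.FluidPDE.curl (u t) z‖) + g t) *
                ‖Literature.Analysis.FluidPDE.curl (u t) x‖ ^ 2) →
      Literature.Analysis.FluidPDE.IsTypeIBlowup u T

/-! ### Bridges to the landed RateReduction file (type-check that the texts match verbatim) -/

/-- `ShellRate2 → B_rate2` IS the landed `Rate.bRate_of_shellRate` (p158280). -/
theorem B_rate2_of_shellRate2 : ShellRate2 → B_rate2 :=
  Theorems.BlowupIsLocallyDriven.Rate.bRate_of_shellRate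

/-- `B_rate2 → B_rate2_xi` IS the landed `Rate.bRateStretch_of_bRate` (p158280). -/
theorem B_rate2_xi_of_B_rate2 : B_rate2 → B_rate2_xi :=
  Theorems.BlowupIsLocallyDriven.Rate.bRateStretch_of_bRate

/-! ### The deciding theorem keeps its shape -/

/-- `A_rate2 ∧ B_rate2 → NoTypeII` (the route's target; pure logic). -/
theorem noTypeII_of_rate2 (hA : A_rate2) (hB : B_rate2) : Theses.CoreLogGas.NoTypeII :=
  fun ν T hν hT u p hmax hlh hdec => hA ν T hν hT u p hmax hlh hdec (hB ν T hν hT u p hmax hlh hdec)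

/-- `A_rate2_xi ∧ B_rate2_xi → NoTypeII` (pure logic). -/
theorem noTypeII_of_rate2_xi (hA : A_rate2_xi) (hB : B_rate2_xi) : Theses.CoreLogGas.NoTypeII :=
  fun ν T hν hT u p hmax hlh hdec => hA ν T hν hT u p hmax hlh hdec (hB ν T hν hT u p hmax hlh hdec)

/-- Deciding theorem under the re-typing `(A_rate2, B_rate2)`: same proof as `CoreLogGas.closes`. -/
theorem closes_rate2 (hA : A_rate2) (hB : B_rate2) (hI : Theses.CoreLogGas.NoTypeIBlowup)
    (hC : Theses.CoreLogGas.NoBlowupToClay) : _root_.NavierStokesRegularity := by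
  refine hC ?_
  intro ν T hν hT u p hcl hlh hdec
  by_contra hne
  have hmax : Literature.Analysis.FluidPDE.IsMaximalSmoothSolution ν 0 u p T := ⟨hcl, hne⟩
  exact hne (hI ν T hν hT u p hcl hlh hdec (noTypeII_of_rate2 hA hB ν T hν hT u p hmax hlh hdec))

/-- Deciding theorem under the re-typing `(A_rate2_xi, B_rate2_xi)`. -/
theorem closes_rate2_xi (hA : A_rate2_xi) (hB : B_rate2_xi) (hI : Theses.CoreLogGas.NoTypeIBlowup)
    (hC : Theses.CoreLogGas.NoBlowupToClay) : _root_.NavierStokesRegularity := by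
  refine hC ?_
  intro ν T hν hT u p hcl hlh hdec
  by_contra hne
  have hmax : Literature.Analysis.FluidPDE.IsMaximalSmoothSolution ν 0 u p T := ⟨hcl, hne⟩
  exact hne (hI ν T hν hT u p hcl hlh hdec (noTypeII_of_rate2_xi hA hB ν T hν hT u p hmax hlh hdec))

/-- With `NoBlowupToClay` already PROVED in the route file, the re-typed route needs exactly `A_rate2`, `B_rate2` and the
shared `NoTypeIBlowup`. -/
theorem closes_rate2' (hA : A_rate2) (hB : B_rate2) (hI : Theses.CoreLogGas.NoTypeIBlowup) :
    _root_.NavierStokesRegularity :=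
  closes_rate2 hA hB hI Theses.CoreLogGas.NoBlowupToClay_holds

end Summit.NavierStokesRegularity.NavierStokesRegularity.Cruxes.BlowupIsLocallyDriven.RestatementC4

end
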